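import Summits.QuantumAdvantage.QuantumAdvantage.Theorems.SosSandwichPseudoBoundedAASymmetricCornerPrep
import Literature.Computability.QuantumComplexity.PseudoBounded
import HarnessLib

/-!
# Crux `PseudoBoundedAA` (stmt-QuantumAdvantage-15237) / `AAConj` (10748) — the SYMMETRIC CORNER, part 2/2:
# the Aaronson–Ambainis conjecture holds for weight-symmetric polynomials, `maxInf ≥ Var²/d⁴`

A `[0,1]`-bounded real polynomial `p` of total degree `≤ d` on `{0,1}^n` whose cube values depend only on the
Hamming weight has a variable of influence `≥ Var[p]²/d⁴` — the Aaronson–Ambainis conjecture on the symmetric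
corner, in the conjectured polynomial shape `C (ε/d)^c` with `(c, C) = (4, 1)`; for pseudo-bounded `p` of order `T`
(degree `≤ 2T` on the cube), `(c, C) = (4, 1/16)` in the shape of the route decl `PseudoBoundedAA`.

* `boolVariance_le_of_symmetric` — `4d² ≤ n ⟹ Var[p] ≤ 4d⁴/n` (part 1's mesh bound `|P| ≤ 2` on `[0,n]`, Markov
  `|P'| ≤ 4d²/n`, Lipschitz `|P(w) − P(n/2)| ≤ (4d²/n)|w − n/2|`, and `E(|x| − n/2)² = n/4`).
* `exists_influence_ge_of_symmetric` — **`∃ i, Var[p]²/d⁴ ≤ Inf_i[p]`** (`4d² ≤ n`: `n ≤ 4d⁴/Var` and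
  `Inf ≥ 4Var/n`; `4d² > n`: `Inf ≥ 4Var/n > Var/d² ≥ Var²/d⁴`).
* `aaConj_symmetricCorner` — the statement of the route decl `AAConj` with the extra hypothesis "weight-symmetric",
  `(c, C) = (4, 1)`; `pseudoBoundedAA_symmetricCorner` — the statement of `PseudoBoundedAA` (15237) with the extra
  hypothesis, `(c, C) = (4, 1/16)` (Literature `PseudoBounded`/`boolVariance`/`influence`, by `rfl` the route's inline
  `ev`/`avg`).

Honest label: a classical special case (symmetric polynomials are governed by univariate approximation theory); no
stub, crux or summit is closed.  Sources: Beals et al. 2001 Lemma 3.2; Ehlich–Zeller 1964; Korneichuk 1991 Thm 3.5.8;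
Aaronson–Ambainis arXiv:0911.0996 Conj. 6; Kaniewski–Lee–de Wolf arXiv:1411.7280 Def. 7.
-/

-- D-0017: single-conjunct summit ⇒ the duplicate `QuantumAdvantage.QuantumAdvantage` is mandated.
set_option linter.dupNamespace false

noncomputable section

open Finset
open Literature.Computability.QuantumComplexity
open Literature.Analysis.Approximation (markov_inequality_Icc)

namespace Summit.QuantumAdvantage.QuantumAdvantage.Theorems.SosSandwich.SymmetricCorner

variable {N : ℕ}

/-- **`Var[p] ≤ 4d⁴/n` for a weight-symmetric `[0,1]`-bounded `p` of degree `≤ d` on `n ≥ 4d²` bits**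
(`|P(w) − P(n/2)| ≤ (4d²/n)|w − n/2|` and `E(|x| − n/2)² = n/4`). [cite: Korneichuk1991, Thm 3.5.8 (§3.5.4)]
[cite: BealsEtAl2001, Lemma 3.2] -/
theorem boolVariance_le_of_symmetric {d : ℕ} (p : MvPolynomial (Fin N) ℝ) (hdeg : p.totalDegree ≤ d)
    (hsym : ∀ x x' : Fin N → Bool,
      (Finset.univ.filter fun k => x k = true).card = (Finset.univ.filter fun k => x' k = true).card →
        evalBool p x = evalBool p x')
    (hb : ∀ x, 0 ≤ evalBool p x ∧ evalBool p x ≤ 1) (hn : 4 * d ^ 2 ≤ N) (hN : 0 < N) :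
    boolVariance p ≤ 4 * (d : ℝ) ^ 4 / N := by
  set P := symPoly N p with hPdef
  have hPdeg : P.natDegree ≤ d := (natDegree_symPoly_le p).trans hdeg
  have hN0 : (0 : ℝ) < (N : ℝ) := by exact_mod_cast hN
  have hint : ∀ k : ℕ, k ≤ N → |P.eval (k : ℝ)| ≤ 1 := by
    intro k hk
    have h := symPoly_eval_nat_mem p hsym hb hk
    rw [abs_le]; constructor <;> linarith [h.1, h.2]
  have hM2 := abs_symPoly_le_two P hPdeg hn hN hint
  -- Lipschitz constant `4d²/n` on `[0,n]`
  have hdegP : P.degree ≤ d := Polynomial.degree_le_of_natDegree_le hPdeg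
  have hderiv : ∀ y ∈ Set.Icc (0 : ℝ) N, |(Polynomial.derivative P).eval y| ≤ 4 * (d : ℝ) ^ 2 / N := by
    intro y hy
    have h := markov_inequality_Icc hdegP hN0 hM2 hy
    have e : 2 * (d : ℝ) ^ 2 * 2 / ((N : ℝ) - 0) = 4 * (d : ℝ) ^ 2 / N := by ring
    rw [e] at h
    exact h
  have hlip : ∀ x ∈ Set.Icc (0 : ℝ) N, ∀ y ∈ Set.Icc (0 : ℝ) N,
      |P.eval y - P.eval x| ≤ 4 * (d : ℝ) ^ 2 / N * |y - x| := by
    intro x hx y hy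
    have h := Convex.norm_image_sub_le_of_norm_deriv_le (f := fun t => P.eval t) (s := Set.Icc (0 : ℝ) N)
      (fun t _ => (Polynomial.differentiable P).differentiableAt)
      (fun t ht => by rw [Polynomial.deriv]; exact hderiv t ht) (convex_Icc _ _) hx hy
    simpa [Real.norm_eq_abs] using h
  -- pointwise: `(p(x) − P(n/2))² ≤ (16 d⁴/n²)(|x| − n/2)²`
  have hmid : ((N : ℝ) / 2) ∈ Set.Icc (0 : ℝ) N := ⟨by positivity, by linarith⟩
  have hpt : ∀ x : Fin N → Bool, (evalBool p x - P.eval ((N : ℝ) / 2)) ^ 2 ≤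
      16 * (d : ℝ) ^ 4 / (N : ℝ) ^ 2 * ((((Finset.univ.filter fun k => x k = true).card : ℕ) : ℝ) - N / 2) ^ 2 := by
    intro x
    have hwle : (Finset.univ.filter fun k => x k = true).card ≤ N :=
      (Finset.card_filter_le _ _).trans (by simp)
    have hwI : (((Finset.univ.filter fun k => x k = true).card : ℕ) : ℝ) ∈ Set.Icc (0 : ℝ) N :=
      ⟨by positivity, by exact_mod_cast hwle⟩
    have h := hlip ((N : ℝ) / 2) hmid (((Finset.univ.filter fun k => x k = true).card : ℕ) : ℝ) hwI
    rw [symPoly_eval_weight p hsym x] at h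
    have h0 : 0 ≤ 4 * (d : ℝ) ^ 2 / N *
        |(((Finset.univ.filter fun k => x k = true).card : ℕ) : ℝ) - N / 2| := by positivity
    calc (evalBool p x - P.eval ((N : ℝ) / 2)) ^ 2
        = |evalBool p x - P.eval ((N : ℝ) / 2)| ^ 2 := (sq_abs _).symm
      _ ≤ (4 * (d : ℝ) ^ 2 / N * |(((Finset.univ.filter fun k => x k = true).card : ℕ) : ℝ) - N / 2|) ^ 2 :=
          pow_le_pow_left₀ (abs_nonneg _) h 2
      _ = 16 * (d : ℝ) ^ 4 / (N : ℝ) ^ 2 * ((((Finset.univ.filter fun k => x k = true).card : ℕ) : ℝ) - N / 2) ^ 2 := by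
          rw [mul_pow, sq_abs]; ring
  -- average
  calc boolVariance p ≤ boolAvg (fun x => (evalBool p x - P.eval ((N : ℝ) / 2)) ^ 2) :=
        boolVariance_le_boolAvg_sq_sub p _
    _ ≤ boolAvg (fun x : Fin N → Bool => 16 * (d : ℝ) ^ 4 / (N : ℝ) ^ 2 *
          ((((Finset.univ.filter fun k => x k = true).card : ℕ) : ℝ) - N / 2) ^ 2) := by
        unfold boolAvg
        exact div_le_div_of_nonneg_right (Finset.sum_le_sum fun x _ => hpt x) (by positivity)
    _ = 16 * (d : ℝ) ^ 4 / (N : ℝ) ^ 2 * boolAvg (fun x : Fin N → Bool =>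
          ((((Finset.univ.filter fun k => x k = true).card : ℕ) : ℝ) - N / 2) ^ 2) := by
        unfold boolAvg
        rw [← Finset.mul_sum, mul_div_assoc]
    _ = 16 * (d : ℝ) ^ 4 / (N : ℝ) ^ 2 * (N / 4) := by rw [boolAvg_weight_sub_half_sq]
    _ = 4 * (d : ℝ) ^ 4 / N := by field_simp; ring

/-! ### §4 The symmetric corner of the Aaronson–Ambainis conjecture -/

/-- **Aaronson–Ambainis on the symmetric corner.**  A `[0,1]`-bounded weight-symmetric real polynomial of total
degree `≤ d` (`d ≥ 1`) with positive variance has a variable of influence `≥ Var[p]²/d⁴`.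
(`4d² ≤ n`: `Var ≤ 4d⁴/n` so `n ≤ 4d⁴/Var`, and `maxInf ≥ 4Var/n`; `4d² > n`: `maxInf ≥ 4Var/n > Var/d² ≥ Var²/d⁴`.)
[cite: AaronsonAmbainis2014, Conj. 6] [cite: Korneichuk1991, Thm 3.5.8 (§3.5.4)] [cite: BealsEtAl2001, Lemma 3.2] -/
theorem exists_influence_ge_of_symmetric {d : ℕ} (p : MvPolynomial (Fin N) ℝ) (hd : 1 ≤ d)
    (hdeg : p.totalDegree ≤ d)
    (hsym : ∀ x x' : Fin N → Bool,
      (Finset.univ.filter fun k => x k = true).card = (Finset.univ.filter fun k => x' k = true).card →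
        evalBool p x = evalBool p x')
    (hb : ∀ x, 0 ≤ evalBool p x ∧ evalBool p x ≤ 1) (hv : 0 < boolVariance p) :
    ∃ i : Fin N, boolVariance p ^ 2 / (d : ℝ) ^ 4 ≤ influence i p := by
  -- `N ≥ 1`: otherwise the variance vanishes
  have hN : 0 < N := by
    rcases Nat.eq_zero_or_pos N with h0 | hpos
    · exfalso
      subst h0
      have : boolVariance p = 0 := by
        unfold boolVariance boolAvg
        simp
      linarith
    · exact hpos
  have hN0 : (0 : ℝ) < (N : ℝ) := by exact_mod_cast hN
  have hd0 : (0 : ℝ) < (d : ℝ) := by exact_mod_cast hd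
  have hd1 : (1 : ℝ) ≤ (d : ℝ) := by exact_mod_cast hd
  have hV1 : boolVariance p ≤ 1 := (boolVariance_le_quarter hb).trans (by norm_num)
  obtain ⟨i, hi⟩ := exists_influence_ge_avg hN p
  refine ⟨i, le_trans ?_ hi⟩
  rw [div_le_div_iff₀ (by positivity) hN0]
  by_cases hn : 4 * d ^ 2 ≤ N
  · -- `Var ≤ 4d⁴/n`, i.e. `Var · n ≤ 4 d⁴`
    have hVn : boolVariance p * N ≤ 4 * (d : ℝ) ^ 4 := by
      have h := boolVariance_le_of_symmetric p hdeg hsym hb hn hN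
      rwa [le_div_iff₀ hN0] at h
    calc boolVariance p ^ 2 * N = boolVariance p * (boolVariance p * N) := by ring
      _ ≤ boolVariance p * (4 * (d : ℝ) ^ 4) := mul_le_mul_of_nonneg_left hVn hv.le
      _ = 4 * boolVariance p * (d : ℝ) ^ 4 := by ring
  · -- `n < 4d²`
    have hn' : (N : ℝ) < 4 * (d : ℝ) ^ 2 := by
      have : N < 4 * d ^ 2 := not_le.mp hn
      exact_mod_cast this
    have hd2 : (d : ℝ) ^ 2 ≤ (d : ℝ) ^ 4 := by
      calc (d : ℝ) ^ 2 = (d : ℝ) ^ 2 * 1 := (mul_one _).symm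
        _ ≤ (d : ℝ) ^ 2 * (d : ℝ) ^ 2 := mul_le_mul_of_nonneg_left (by nlinarith) (by positivity)
        _ = (d : ℝ) ^ 4 := by ring
    calc boolVariance p ^ 2 * N ≤ boolVariance p ^ 2 * (4 * (d : ℝ) ^ 2) :=
          mul_le_mul_of_nonneg_left hn'.le (sq_nonneg _)
      _ = 4 * boolVariance p * (boolVariance p * (d : ℝ) ^ 2) := by ring
      _ ≤ 4 * boolVariance p * (1 * (d : ℝ) ^ 4) := by
          apply mul_le_mul_of_nonneg_left _ (by positivity)
          exact mul_le_mul hV1 hd2 (by positivity) (by norm_num)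
      _ = 4 * boolVariance p * (d : ℝ) ^ 4 := by ring

/-- **The statement of the route decl `AAConj` on the symmetric corner** (`(c, C) = (4, 1)`): for all `N`, `d ≥ 1`,
every `[0,1]`-bounded weight-symmetric `p` of total degree `≤ d` and every `0 < ε ≤ Var[p]`, some variable has
`1·(ε/d)⁴ ≤ Inf_i[p]`. [cite: AaronsonAmbainis2014, Conj. 6] -/
theorem aaConj_symmetricCorner (N d : ℕ) (p : MvPolynomial (Fin N) ℝ) (ε : ℝ)
    (hsym : ∀ x x' : Fin N → Bool,
      (Finset.univ.filter fun k => x k = true).card = (Finset.univ.filter fun k => x' k = true).card →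
        evalBool p x = evalBool p x')
    (hd : 1 ≤ d) (hdeg : p.totalDegree ≤ d) (hb : ∀ x, 0 ≤ evalBool p x ∧ evalBool p x ≤ 1)
    (hε : 0 < ε) (hεV : ε ≤ boolVariance p) :
    ∃ i : Fin N, 1 * (ε / d) ^ 4 ≤ influence i p := by
  obtain ⟨i, hi⟩ := exists_influence_ge_of_symmetric p hd hdeg hsym hb (lt_of_lt_of_le hε hεV)
  refine ⟨i, le_trans ?_ hi⟩
  have hd0 : (0 : ℝ) < (d : ℝ) := by exact_mod_cast hd
  have hV1 : boolVariance p ≤ 1 := (boolVariance_le_quarter hb).trans (by norm_num)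
  have hε1 : ε ≤ 1 := hεV.trans hV1
  rw [one_mul, div_pow]
  apply div_le_div_of_nonneg_right _ (by positivity)
  calc ε ^ 4 ≤ ε ^ 2 := pow_le_pow_of_le_one hε.le hε1 (by norm_num)
    _ ≤ boolVariance p ^ 2 := pow_le_pow_left₀ hε.le hεV 2

/-- **The statement of the route decl `SosSandwich.PseudoBoundedAA` (stmt-QuantumAdvantage-15237) on the symmetric
corner** (`(c, C) = (4, 1/16)`): a pseudo-bounded `p` of order `T ≥ 1` (hence of degree `≤ 2T` on the cube) that is
weight-symmetric, with `0 < ε ≤ Var[p]`, has a variable with `(1/16)(ε/T)⁴ ≤ Inf_i[p]`.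
[cite: AaronsonAmbainis2014, Conj. 6] [cite: KaniewskiLeeDewolf2015, Def. 7] -/
theorem pseudoBoundedAA_symmetricCorner (N T : ℕ) (p : MvPolynomial (Fin N) ℝ) (ε : ℝ)
    (hsym : ∀ x x' : Fin N → Bool,
      (Finset.univ.filter fun k => x k = true).card = (Finset.univ.filter fun k => x' k = true).card →
        evalBool p x = evalBool p x')
    (hT : 1 ≤ T) (hpb : PseudoBounded T p) (hε : 0 < ε) (hεV : ε ≤ boolVariance p) :
    ∃ i : Fin N, (1 / 16) * (ε / T) ^ 4 ≤ influence i p := by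
  -- a representing polynomial of total degree `≤ 2T` with the same cube values
  obtain ⟨m, q, r, hqr, hval⟩ := hpb
  set P : MvPolynomial (Fin N) ℝ := ∑ j, q j ^ 2 with hP
  have hPdeg : P.totalDegree ≤ 2 * T := by
    refine (MvPolynomial.totalDegree_finsetSum _ _).trans (Finset.sup_le fun j _ => ?_)
    calc (q j ^ 2).totalDegree ≤ 2 * (q j).totalDegree := MvPolynomial.totalDegree_pow _ _
      _ ≤ 2 * T := Nat.mul_le_mul_left 2 (hqr j).1
  have hPval : ∀ x, evalBool P x = evalBool p x := by
    intro x
    unfold evalBool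
    rw [hP, map_sum]
    have h1 := (hval x).1
    change evalBool p x = ∑ j, evalBool (q j) x ^ 2 at h1
    unfold evalBool at h1
    rw [h1]
    exact Finset.sum_congr rfl fun j _ => by rw [map_pow]
  have hb : ∀ x, 0 ≤ evalBool p x ∧ evalBool p x ≤ 1 := by
    intro x
    have h1 := (hval x).1
    have h2 := (hval x).2
    change evalBool p x = ∑ j, evalBool (q j) x ^ 2 at h1
    change 1 - evalBool p x = ∑ j, evalBool (r j) x ^ 2 at h2
    constructor
    · rw [h1]; exact Finset.sum_nonneg fun j _ => sq_nonneg _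
    · have : 0 ≤ ∑ j, evalBool (r j) x ^ 2 := Finset.sum_nonneg fun j _ => sq_nonneg _
      linarith
  -- transfer variance / influences / symmetry / bounds to `P`
  have hfun : evalBool P = evalBool p := funext hPval
  have hVP : boolVariance P = boolVariance p := by unfold boolVariance; rw [hfun]
  have hIP : ∀ i, influence i P = influence i p := by intro i; unfold influence; rw [hfun]
  have hsymP : ∀ x x' : Fin N → Bool,
      (Finset.univ.filter fun k => x k = true).card = (Finset.univ.filter fun k => x' k = true).card →
        evalBool P x = evalBool P x' := by
    intro x x' h; rw [hPval, hPval]; exact hsym x x' h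
  have hbP : ∀ x, 0 ≤ evalBool P x ∧ evalBool P x ≤ 1 := by intro x; rw [hPval]; exact hb x
  have h2T : 1 ≤ 2 * T := by omega
  have hεVP : ε ≤ boolVariance P := by rw [hVP]; exact hεV
  obtain ⟨i, hi⟩ := aaConj_symmetricCorner N (2 * T) P ε hsymP h2T hPdeg hbP hε hεVP
  refine ⟨i, ?_⟩
  rw [hIP] at hi
  refine le_trans (le_of_eq ?_) hi
  push_cast
  ring

end Summit.QuantumAdvantage.QuantumAdvantage.Theorems.SosSandwich.SymmetricCorner

end
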